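/-
Copyright (c) 2026 the pub-hodgecm-mathlib formalisation cell (harness21).  Prover seat hodgecm-mathlib-K2Liu-p03 (g8), Track B «K2-LIT»,
#184♮ = hLiu418 = `stmt-HodgeConjecture-24832`; socket #41, KIND 1 — (K1a-T)(L5-den) THE SHELL-POLYNOMIAL SIZE LETTER IN THE `D`-CURRENCY:
`‖∏_{v∈D S h} Σ_{k≤mτ S v}(ε_v q_v^{1−2s})^k‖ ≤ C·(1+τa S)^{N₄}·D^{N₅}` near every `z ∈ {0 < re}`, for the witnesses of ★ p864217 (A) `htail_hsplit_witnesses_of_record`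
(K1-a♮ line lead K2E5-p16 (g8) WORD #12 (1)(2) 2026-09-05T01:20:29Z: the currency of record and «THEN (L5-den)»).
THEOREMS ONLY (no `def`, no `instance`, no notation, no named-fact hypothesis, no `sorry`).
-/
import Summits.HodgeConjecture.HodgeConjecture.Theorems.K2LiuKindOneSingularTailWitnesses        -- ★ p864217 (A) ED. 2 (this seat): the witnesses' defining letters (g)(h4)(h5)(j)
import Summits.HodgeConjecture.HodgeConjecture.Theorems.K2LiuSiegelEisensteinKindWFinitePlaces    -- ★ FILE 2c: `prod_pow_absNorm_le_abs_norm_of_valuation_le`, `abs_norm_le_pow_of_apply_le`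
import Summits.HodgeConjecture.HodgeConjecture.Theorems.K2LiuKindWFinitePartLettersOfRecord       -- ★ `valuation_le_one_of_isIntegral`
import Summits.HodgeConjecture.HodgeConjecture.Theorems.K2LiuTwistedPolyBound                    -- ★ p864355 (L5-ii) (LH7-p05): `norm_twistedPoly_le`
import HarnessLib

/-!
# Crux `HLiu418`, socket #41, KIND 1 a♮ — (K1a-T)(L5-den) `K2LiuKindOneSingularShellSize`: THE SHELL POLYNOMIALS OF THE SINGULAR TAIL ARE POLYNOMIALLY BOUNDED IN `(1 + τa S)·D`

Cell `hodgecm-mathlib`, crux item hLiu418 = `stmt-HodgeConjecture-24832` (helper lane `--supports … --as helper`, count-neutral), route of record `HCCMUnconditional`;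
squad K2 ∕ K2Liu, road `K2_Liu`, socket #41, KIND 1, block K1-a♮.  CONSUMER: K2E4-p10 (g10)'s `hdec_of_factorBounds_den` (the (L5) slot `hPb` of ★ p863488 in the
`D`-currency of desk WORD #12), fed at the tie from ★ p864217's `obtain`.

THE LETTER.  With the witnesses of ★ (A) — the shell set `D S h = {v : |ι_v τ(σc S)|_v ≠ 1} ∖ T S h` (h4), the exponents `mτ S v = ord_v τ(σc S)` (h5), `τ` integral off
`T S h` (j), the rank-one presentation (g) — a NORMALISED row section (`hnorm`), one S-sized letter BY VALUE (LH7-p05 (g3) (L5-i) `exists_cornerScalar_tau_letters` =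
integrality of `D·d₀·τ(σc S)` + its archimedean size) and ★ p864355 (L5-ii) `norm_twistedPoly_le` (`‖Σ_{k≤m}(ε q^{1−2s})^k‖ ≤ (q^m)^c` for `2 + 2|re s| ≤ c`) BY NAME:
`∀ z, 0 < re z → ∃ N₄ N₅ C a r, … ∀ S s, dist s z < r → ∀ h, rank-one → ∀ D ≥ 1, D·S ℤ-integral →
 ‖∏_{v∈D S h} Σ_{k ≤ mτ S v}(ε_v q_v^{1−2s})^k‖ ≤ C · ‖h‖^a · (1 + τa S)^{N₄} · D^{N₅}` (`a = 0`, `r = 1`, `N₄ = N₅ = [L⁺:ℚ]·c(z)`, `c(z) = 4 + 2⌈|re z|⌉`).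
Proof: per place ★ (L5-ii) with `|ε_v| = 1` (★ `norm_valueAtUniformizer_of_isUnitary`, `ε_{L∕L⁺}` of finite order ★ HKS); then
`∏_{v∈D S h} q_v^{mτ S v} ≤ |N_{L⁺∕ℚ}(D d₀ τ)| ≤ (D d₀ Cτ τa S)^{[L⁺:ℚ]}` (★ FILE 2c `prod_pow_absNorm_le_abs_norm_of_valuation_le` — on `D S h`, `|ι_v(D d₀ τ)|_v ≤ |ι_v τ|_v = q_v^{−mτ S v}`
by (h4)(h5)(j) — and ★ `abs_norm_le_pow_of_apply_le` with (L5-i)'s archimedean letter at `B := τa S`).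
* **`norm_prod_shell_le_den`** — the letter.
HONEST LABEL.  Count-neutral helper; it closes no socket: `HC_CM` is proved only modulo the 7 printed citations (2 remaining named inputs: hLiu418 =
`stmt-HodgeConjecture-24832`, h413 = `stmt-HodgeConjecture-24833`) until rung 0 closes.

## References
* [KudlaRallis1994] S. Kudla, S. Rallis, *A regularized Siegel–Weil formula: the first term identity*, Ann. of Math. 140 (1994): §2 (2.10)–(2.12).
* [Tan1999] V. Tan, *Poles of Siegel Eisenstein series on U(n,n)*, Canad. J. Math. 51 (1999): §4 Prop. 4.8.
* [NeukirchANT1999] J. Neukirch, *Algebraic Number Theory* (1999): Ch. III §1 (product formula), Ch. VII (5.2).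
* [Shimura1997] G. Shimura, *Euler Products and Eisenstein Series*, CBMS 93 (1997): §18.4 Prop. 18.14.
-/

set_option autoImplicit false
-- the mandated namespace repeats the single-problem summit's segment (`HodgeConjecture.HodgeConjecture`)
set_option linter.dupNamespace false

noncomputable section

open scoped Matrix NNReal
open NumberField IsDedekindDomain

namespace Summit.HodgeConjecture.HodgeConjecture.Cruxes.HLiu418.K2LiuKindOneSingularShellSize

open Literature.NumberTheory.Automorphic Literature.NumberTheory.Automorphic.UnitaryGroup Literature.NumberTheory.GaloisRepresentations
open Literature.NumberTheory.GelbartRogawski1991 Literature.NumberTheory.GelbartRogawski1991.GRConstruction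
open Literature.NumberTheory.GelbartRogawski1991.AdaptedBlocks
open Literature.NumberTheory.GelbartRogawski1991.UnitaryDualPair
open Literature.NumberTheory.K2Lit.SiegelDoubled
open Summit.HodgeConjecture.HodgeConjecture.Cruxes.HLiu418.K2LiuSiegelUnipotentLocalDefs
open Summit.HodgeConjecture.HodgeConjecture.Cruxes.HLiu418.K2LiuSiegelUnipotentSplitDefs
open Summit.HodgeConjecture.HodgeConjecture.Cruxes.HLiu418.K2LiuSiegelUnipotentSplitAtDefs
open Summit.HodgeConjecture.HodgeConjecture.Cruxes.HLiu418.K2LiuSiegelUnipotentFourierDefs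
open Summit.HodgeConjecture.HodgeConjecture.Cruxes.HLiu418.K2LiuSiegelMiddleCellLeviCriterion (row_ne_zero)
open Summit.HodgeConjecture.HodgeConjecture.Cruxes.HLiu418.K2LiuSiegelEisensteinKindWFinitePlaces
  (prod_pow_absNorm_le_abs_norm_of_valuation_le abs_norm_le_pow_of_apply_le)
open Summit.HodgeConjecture.HodgeConjecture.Cruxes.HLiu418.K2LiuKindWFinitePartLettersOfRecord (valuation_le_one_of_isIntegral)
open Summit.HodgeConjecture.HodgeConjecture.Cruxes.HLiu418.K2LiuTwistedPolyBound (norm_twistedPoly_le)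

variable (L : Type) [Field L] [NumberField L] [IsCMField L]

section Size

variable {N M : ℕ} (e : Fin N × Fin M ≃ Fin 2)
  (dV : Fin N → L) (hdV : ∀ i, IsCMField.complexConj L (dV i) = dV i)
  (dW : Fin M → L) (hdW : ∀ i, IsCMField.complexConj L (dW i) = dW i)

open Classical in -- the archimedean size `‖(ι_∞ S_ab)_ab‖` is read with the consumers' instances (★ p863404 ∕ ★ p864122: `open Classical in`)
/-- **(K1a-T)(L5-den) THE SHELL-POLYNOMIAL SIZE LETTER IN THE `D`-CURRENCY.**  DATA (all by value; the tie passes ★ names positionally): a NORMALISED row section `γ`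
(`hnorm` = ★ `exists_normalised_rowSection`'s entry letter); the two S-sized letters of LH7-p05 (g3) — (L5-i) `d₀ Cτ hd₀ hCτ hτ` (`exists_cornerScalar_tau_letters`: integrality of
`D·d₀·τ(σ)` in `L⁺` and `|τ(σ)|_w ≤ Cτ·B` whenever the pivot entry is archimedeanly `≤ B`); the bad and record sets `T₀ T_rec`;
★ (A)'s witnesses `σc T D mτ u w hw` with its letters (g) `hpres`, (h4) `hDmem`, (h5) `hmτ`, (j) `hoff`; the archimedean size `τa` (`hτa`).  THEN, near every `z` with
`0 < re z` (`r = 1`, `a = 0`, `N₄ = N₅ = [L⁺:ℚ]·(4 + 2⌈|re z|⌉)`):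
`‖∏_{v∈D S h} Σ_{k≤mτ S v}(ε_v q_v^{1−2s})^k‖ ≤ C · ‖h‖^a · (1 + τa S)^{N₄} · D^{N₅}` for rank-one `S`, `dist s z < r`, every `h`, every `D ≥ 1` with `D·S` ℤ-integral.
[cite: KudlaRallis1994, §2 (2.10)–(2.12)] [cite: Tan1999, §4 Prop. 4.8] [cite: NeukirchANT1999, Ch. III §1] [cite: Shimura1997, §18.4 Prop. 18.14] -/
theorem norm_prod_shell_le_den
    -- a NORMALISED row section
    (γ : Projectivization L (Fin 2 → L) → GL (Fin 2) L)
    (hnorm : ∀ (w : Fin 2 → L) (hw : w ≠ 0), ∃ i : Fin 2, w i ≠ 0 ∧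
      (γ (Projectivization.mk L w hw) : Matrix (Fin 2) (Fin 2) L) 1 = (w i)⁻¹ • w ∧
      ∀ a b : Fin 2,
        (∃ k : Fin 2, (γ (Projectivization.mk L w hw) : Matrix (Fin 2) (Fin 2) L) a b = 0 ∨
          (γ (Projectivization.mk L w hw) : Matrix (Fin 2) (Fin 2) L) a b = 1 ∨
          (γ (Projectivization.mk L w hw) : Matrix (Fin 2) (Fin 2) L) a b = (w i)⁻¹ * w k ∨
          (γ (Projectivization.mk L w hw) : Matrix (Fin 2) (Fin 2) L) a b = -((w i)⁻¹ * w k)) ∧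
        (∃ k : Fin 2, (((γ (Projectivization.mk L w hw))⁻¹ : GL (Fin 2) L) : Matrix (Fin 2) (Fin 2) L) a b = 0 ∨
          (((γ (Projectivization.mk L w hw))⁻¹ : GL (Fin 2) L) : Matrix (Fin 2) (Fin 2) L) a b = 1 ∨
          (((γ (Projectivization.mk L w hw))⁻¹ : GL (Fin 2) L) : Matrix (Fin 2) (Fin 2) L) a b = (w i)⁻¹ * w k ∨
          (((γ (Projectivization.mk L w hw))⁻¹ : GL (Fin 2) L) : Matrix (Fin 2) (Fin 2) L) a b = -((w i)⁻¹ * w k)))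
    -- (L5-i) the `τ`-letters of the corner scalar BY VALUE (LH7-p05 (g3) `exists_cornerScalar_tau_letters`)
    (d₀ : ℕ) (Cτ : ℝ) (hd₀ : d₀ ≠ 0) (hCτ : 0 ≤ Cτ)
    (hτ : ∀ (σ x : L) (k : Fin 2) (D : ℕ), D ≠ 0 → IsIntegral ℤ ((D : L) * x) →
      ((gramR L e dV hdV dW hdW).map (algebraMap (Fp L) L)) k k * x = ((gramR L e dV hdV dW hdW).map (algebraMap (Fp L) L)) 1 1 * σ →
      IsIntegral ℤ (((D * d₀ : ℕ) : Fp L) * (gramR L e dV hdV dW hdW 1 1 * Algebra.trace (Fp L) L (σ * imagUnit L))) ∧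
      ∀ B : ℝ, (∀ w' : NumberField.InfinitePlace L, w' x ≤ B) →
        ∀ w : NumberField.InfinitePlace (Fp L), w (gramR L e dV hdV dW hdW 1 1 * Algebra.trace (Fp L) L (σ * imagUnit L)) ≤ Cτ * B)
    -- the bad set, the record set, and ★ (A)'s witnesses with their defining letters (g)(h4)(h5)(j), BY VALUE
    (T₀ Trec : Finset (HeightOneSpectrum (𝓞 (Fp L))))
    (σc : skewMatrices ((IsCMField.complexConj L : L ≃ₐ[Fp L] L) : L →+* L) ((gramR L e dV hdV dW hdW).map (algebraMap (Fp L) L)) → L)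
    (T D : skewMatrices ((IsCMField.complexConj L : L ≃ₐ[Fp L] L) : L →+* L) ((gramR L e dV hdV dW hdW).map (algebraMap (Fp L) L)) → HA L e dV hdV dW hdW →
      Finset (HeightOneSpectrum (𝓞 (Fp L))))
    (mτ : skewMatrices ((IsCMField.complexConj L : L ≃ₐ[Fp L] L) : L →+* L) ((gramR L e dV hdV dW hdW).map (algebraMap (Fp L) L)) → HeightOneSpectrum (𝓞 (Fp L)) → ℕ)
    (u w : skewMatrices ((IsCMField.complexConj L : L ≃ₐ[Fp L] L) : L →+* L) ((gramR L e dV hdV dW hdW).map (algebraMap (Fp L) L)) → Fin 2 → L)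
    (hw : ∀ S, w S ≠ 0)
    (hpres : ∀ S : skewMatrices ((IsCMField.complexConj L : L ≃ₐ[Fp L] L) : L →+* L) ((gramR L e dV hdV dW hdW).map (algebraMap (Fp L) L)),
      (S : Matrix (Fin 2) (Fin 2) L) ≠ 0 → (S : Matrix (Fin 2) (Fin 2) L).det = 0 →
        (S : Matrix (Fin 2) (Fin 2) L) = Matrix.vecMulVec (u S) (w S) ∧
        (∀ k : Fin 2, ((gramR L e dV hdV dW hdW).map (algebraMap (Fp L) L)) k k * (S : Matrix (Fin 2) (Fin 2) L) k k =
          IsCMField.complexConj L (((γ (Projectivization.mk L (w S) (hw S)) : GL (Fin 2) L) : Matrix (Fin 2) (Fin 2) L) 1 k) *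
            ((gramR L e dV hdV dW hdW).map (algebraMap (Fp L) L)) 1 1 * σc S * ((γ (Projectivization.mk L (w S) (hw S)) : GL (Fin 2) L) : Matrix (Fin 2) (Fin 2) L) 1 k) ∧
        gramR L e dV hdV dW hdW 1 1 * Algebra.trace (Fp L) L (σc S * imagUnit L) ≠ 0)
    (hDmem : ∀ S : skewMatrices ((IsCMField.complexConj L : L ≃ₐ[Fp L] L) : L →+* L) ((gramR L e dV hdV dW hdW).map (algebraMap (Fp L) L)),
      (S : Matrix (Fin 2) (Fin 2) L) ≠ 0 → (S : Matrix (Fin 2) (Fin 2) L).det = 0 → ∀ (h : HA L e dV hdV dW hdW) (v : HeightOneSpectrum (𝓞 (Fp L))),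
        v ∈ D S h ↔ Valued.v (algebraMap (Fp L) (v.adicCompletion (Fp L)) (gramR L e dV hdV dW hdW 1 1 * Algebra.trace (Fp L) L (σc S * imagUnit L))) ≠ 1 ∧ v ∉ T S h)
    (hmτ : ∀ S (v : HeightOneSpectrum (𝓞 (Fp L))),
      mτ S v = (-WithZero.log (Valued.v (algebraMap (Fp L) (v.adicCompletion (Fp L)) (gramR L e dV hdV dW hdW 1 1 * Algebra.trace (Fp L) L (σc S * imagUnit L))))).toNat)
    (hoff : ∀ S (h : HA L e dV hdV dW hdW) (v : HeightOneSpectrum (𝓞 (Fp L))), v ∉ T S h →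
      v ∉ T₀ ∧ v ∉ Trec ∧ Valued.v (algebraMap (Fp L) (v.adicCompletion (Fp L)) (gramR L e dV hdV dW hdW 1 1 * Algebra.trace (Fp L) L (σc S * imagUnit L))) ≤ 1)
    -- the archimedean size
    (τa : skewMatrices ((IsCMField.complexConj L : L ≃ₐ[Fp L] L) : L →+* L) ((gramR L e dV hdV dW hdW).map (algebraMap (Fp L) L)) → ℝ)
    (hτa : ∀ S : skewMatrices ((IsCMField.complexConj L : L ≃ₐ[Fp L] L) : L →+* L) ((gramR L e dV hdV dW hdW).map (algebraMap (Fp L) L)),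
      ‖(fun i j => NumberField.mixedEmbedding L ((S : Matrix (Fin 2) (Fin 2) L) i j))‖ ≤ τa S) :
    ∀ z : ℂ, 0 < z.re → ∃ (N₄ N₅ : ℕ) (C a r : ℝ), 0 ≤ C ∧ 0 ≤ a ∧ 0 < r ∧
      ∀ (S : skewMatrices ((IsCMField.complexConj L : L ≃ₐ[Fp L] L) : L →+* L) ((gramR L e dV hdV dW hdW).map (algebraMap (Fp L) L))) (s : ℂ), dist s z < r →
      ∀ h : HA L e dV hdV dW hdW, (S : Matrix (Fin 2) (Fin 2) L) ≠ 0 → (S : Matrix (Fin 2) (Fin 2) L).det = 0 →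
      ∀ D' : ℕ, 1 ≤ D' → (∀ a b, IsIntegral ℤ ((D' : L) * (S : Matrix (Fin 2) (Fin 2) L) a b)) →
        ‖∏ v ∈ D S h, ∑ k ∈ Finset.range (mτ S v + 1), ((quadraticHeckeCharCM L).valueAtUniformizer v * (v.residueCard : ℂ) ^ (1 - 2 * s)) ^ k‖ ≤
          C * adelicHeightGL (2 + 2) L (h : GL (Fin (2 + 2)) (AdeleRing (𝓞 L) L)) ^ a * (1 + τa S) ^ N₄ * (D' : ℝ) ^ N₅ := by
  intro z hz
  -- `|ε_v| ≤ 1` (ε_{L∕L⁺} is unitary: finite order ★ HKS)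
  have hεu : (quadraticHeckeCharCM L).IsUnitary :=
    (Literature.RepresentationTheory.HarrisKudlaSweet1996.isFiniteOrder_quadraticHeckeCharCM (L := L)).isUnitary
  have hε : ∀ v : HeightOneSpectrum (𝓞 (Fp L)), ‖(quadraticHeckeCharCM L).valueAtUniformizer v‖ ≤ 1 := fun v =>
    (HeckeCharacter.norm_valueAtUniformizer_of_isUnitary hεu v).le
  -- THE CONSTANTS: `c(z) = 4 + 2⌈|re z|⌉`, `r = 1`, `a = 0`
  refine ⟨Module.finrank ℚ (Fp L) * (4 + 2 * ⌈|z.re|⌉₊), Module.finrank ℚ (Fp L) * (4 + 2 * ⌈|z.re|⌉₊),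
    (((d₀ : ℝ) * (Cτ + 1)) ^ Module.finrank ℚ (Fp L)) ^ (4 + 2 * ⌈|z.re|⌉₊), 0, 1, by positivity, le_rfl, one_pos,
    fun S s hs h hS0 hdet D' hD' hDS => ?_⟩
  -- the exponent letter `2 + 2|re s| ≤ c(z)` on the ball `dist s z < 1`
  have hc : 2 + 2 * |s.re| ≤ ((4 + 2 * ⌈|z.re|⌉₊ : ℕ) : ℝ) := by
    have h1 : |s.re - z.re| < 1 := by
      have h' := Complex.abs_re_le_norm (s - z)
      rw [Complex.sub_re] at h'
      rw [dist_eq_norm] at hs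
      exact h'.trans_lt hs
    have h2 : |s.re| ≤ |z.re| + 1 := by
      have := abs_add_le (s.re - z.re) z.re
      rw [sub_add_cancel] at this
      linarith
    have h3 : (|z.re| : ℝ) ≤ (⌈|z.re|⌉₊ : ℝ) := Nat.le_ceil _
    push_cast
    linarith
  -- the objects of record for this `(S, h, D')`
  obtain ⟨-, hdiag, hτ0⟩ := hpres S hS0 hdet
  obtain ⟨i, hi, hrow, -⟩ := hnorm (w S) (hw S)
  have hD0 : D' ≠ 0 := by omega
  have hDd0 : D' * d₀ ≠ 0 := mul_ne_zero hD0 hd₀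
  have h1i : ((γ (Projectivization.mk L (w S) (hw S)) : GL (Fin 2) L) : Matrix (Fin 2) (Fin 2) L) 1 i = 1 := by
    rw [hrow, Pi.smul_apply, smul_eq_mul, inv_mul_cancel₀ hi]
  have hpiv : ((gramR L e dV hdV dW hdW).map (algebraMap (Fp L) L)) i i * (S : Matrix (Fin 2) (Fin 2) L) i i =
      ((gramR L e dV hdV dW hdW).map (algebraMap (Fp L) L)) 1 1 * σc S := by
    rw [hdiag i, h1i, map_one, one_mul, mul_one]
  obtain ⟨hyint, harch⟩ := hτ (σc S) ((S : Matrix (Fin 2) (Fin 2) L) i i) i D' hD0 (hDS i i) hpiv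
  -- abbreviations: `τ := t₁·Tr(σc(S)δ) ∈ L⁺`, `y := D'·d₀·τ`
  set τ : Fp L := gramR L e dV hdV dW hdW 1 1 * Algebra.trace (Fp L) L (σc S * imagUnit L) with hτdef
  set y : Fp L := ((D' * d₀ : ℕ) : Fp L) * τ with hydef
  have hy0 : y ≠ 0 := mul_ne_zero (by exact_mod_cast hDd0) hτ0
  have hnint : IsIntegral ℤ (((D' * d₀ : ℕ) : Fp L)) := by
    have h' : IsIntegral ℤ (algebraMap ℤ (Fp L) ((D' * d₀ : ℕ) : ℤ)) := isIntegral_algebraMap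
    rwa [map_natCast] at h'
  -- (1) on the shell set, `|y|_v ≤ |τ|_v = q_v^{−mτ S v}`
  have hval : ∀ v ∈ D S h, Valued.v (y : v.adicCompletion (Fp L)) ≤ WithZero.exp (-(mτ S v : ℤ)) := by
    intro v hv
    obtain ⟨-, hvT⟩ := (hDmem S hS0 hdet h v).1 hv
    have hle : v.valuation (Fp L) τ ≤ 1 := by
      have h' := (hoff S h v hvT).2.2
      rwa [HeightOneSpectrum.algebraMap_adicCompletion, Function.comp_apply, Algebra.algebraMap_self_apply,
        HeightOneSpectrum.valuedAdicCompletion_eq_valuation'] at h'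
    have hx0 : v.valuation (Fp L) τ ≠ 0 := (Valuation.ne_zero_iff _).2 hτ0
    have hlog : WithZero.log (v.valuation (Fp L) τ) ≤ 0 := (WithZero.log_le_iff_le_exp hx0).2 (by rwa [WithZero.exp_zero])
    have hm : ((mτ S v : ℕ) : ℤ) = -WithZero.log (v.valuation (Fp L) τ) := by
      rw [hmτ S v, HeightOneSpectrum.algebraMap_adicCompletion, Function.comp_apply, Algebra.algebraMap_self_apply,
        HeightOneSpectrum.valuedAdicCompletion_eq_valuation', Int.toNat_of_nonneg (neg_nonneg.2 hlog)]
    have hDle : v.valuation (Fp L) (((D' * d₀ : ℕ) : Fp L)) ≤ 1 := valuation_le_one_of_isIntegral (Fp L) v hnint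
    rw [HeightOneSpectrum.valuedAdicCompletion_eq_valuation', hydef, map_mul]
    calc v.valuation (Fp L) (((D' * d₀ : ℕ) : Fp L)) * v.valuation (Fp L) τ
        ≤ 1 * v.valuation (Fp L) τ := mul_le_mul_left hDle _
      _ = WithZero.exp (-(mτ S v : ℤ)) := by rw [one_mul, hm, neg_neg, WithZero.exp_log hx0]
  -- (2) `∏_{v∈D S h} q_v^{mτ S v} ≤ |N_{L⁺∕ℚ}(y)| ≤ (D' d₀ Cτ τa S)^{[L⁺:ℚ]}`
  have hprod : ∏ v ∈ D S h, ((v.residueCard : ℕ) : ℝ) ^ mτ S v ≤ |((Algebra.norm ℚ y : ℚ) : ℝ)| :=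
    prod_pow_absNorm_le_abs_norm_of_valuation_le (Fp L) y hy0 hyint (D S h) (mτ S) hval
  have hτa0 : 0 ≤ τa S := (norm_nonneg _).trans (hτa S)
  have hentry : ∀ w' : NumberField.InfinitePlace L, w' ((S : Matrix (Fin 2) (Fin 2) L) i i) ≤ τa S := by
    intro w'
    rw [← NumberField.mixedEmbedding.normAtPlace_apply w' ((S : Matrix (Fin 2) (Fin 2) L) i i)]
    have h1 : NumberField.mixedEmbedding.normAtPlace w' (NumberField.mixedEmbedding L ((S : Matrix (Fin 2) (Fin 2) L) i i)) ≤
        ‖NumberField.mixedEmbedding L ((S : Matrix (Fin 2) (Fin 2) L) i i)‖ := by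
      rw [NumberField.mixedEmbedding.norm_eq_sup'_normAtPlace]
      exact Finset.le_sup' (fun w => NumberField.mixedEmbedding.normAtPlace w (NumberField.mixedEmbedding L ((S : Matrix (Fin 2) (Fin 2) L) i i)))
        (Finset.mem_univ w')
    have h2 : ‖NumberField.mixedEmbedding L ((S : Matrix (Fin 2) (Fin 2) L) i i)‖ ≤ ‖(fun a b => NumberField.mixedEmbedding L ((S : Matrix (Fin 2) (Fin 2) L) a b))‖ :=
      (norm_le_pi_norm ((fun a b => NumberField.mixedEmbedding L ((S : Matrix (Fin 2) (Fin 2) L) a b)) i) i).trans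
        (norm_le_pi_norm (fun a b => NumberField.mixedEmbedding L ((S : Matrix (Fin 2) (Fin 2) L) a b)) i)
    exact h1.trans (h2.trans (hτa S))
  have hnormy : |((Algebra.norm ℚ y : ℚ) : ℝ)| ≤ (((D' * d₀ : ℕ) : ℝ) * (Cτ * τa S)) ^ Module.finrank ℚ (Fp L) := by
    refine abs_norm_le_pow_of_apply_le (Fp L) y fun w₁ => ?_
    rw [hydef, map_mul, ← NumberField.InfinitePlace.norm_embedding_eq w₁ (((D' * d₀ : ℕ) : Fp L)), map_natCast, Complex.norm_natCast]
    exact mul_le_mul_of_nonneg_left (harch (τa S) hentry w₁) (Nat.cast_nonneg _)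
  -- (3) per place: `‖P_v(s)‖ ≤ (q_v^{mτ S v})^{c}`
  have hplace : ∀ v ∈ D S h, ‖∑ k ∈ Finset.range (mτ S v + 1), ((quadraticHeckeCharCM L).valueAtUniformizer v * (v.residueCard : ℂ) ^ (1 - 2 * s)) ^ k‖ ≤
      (((v.residueCard : ℕ) : ℝ) ^ mτ S v) ^ (4 + 2 * ⌈|z.re|⌉₊) := fun v _ =>
    norm_twistedPoly_le _ (hε v) v.one_lt_residueCard (mτ S v) s hc
  -- ASSEMBLY
  have hbase0 : 0 ≤ ((D' * d₀ : ℕ) : ℝ) * (Cτ * τa S) := mul_nonneg (Nat.cast_nonneg _) (mul_nonneg hCτ hτa0)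
  have hbase : ((D' * d₀ : ℕ) : ℝ) * (Cτ * τa S) ≤ ((D' : ℝ) * d₀) * ((Cτ + 1) * (1 + τa S)) := by
    push_cast
    exact mul_le_mul_of_nonneg_left (by nlinarith) (by positivity)
  rw [norm_prod, Real.rpow_zero, mul_one]
  calc ∏ v ∈ D S h, ‖∑ k ∈ Finset.range (mτ S v + 1), ((quadraticHeckeCharCM L).valueAtUniformizer v * (v.residueCard : ℂ) ^ (1 - 2 * s)) ^ k‖
      ≤ ∏ v ∈ D S h, (((v.residueCard : ℕ) : ℝ) ^ mτ S v) ^ (4 + 2 * ⌈|z.re|⌉₊) := Finset.prod_le_prod (fun v _ => norm_nonneg _) hplace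
    _ = (∏ v ∈ D S h, ((v.residueCard : ℕ) : ℝ) ^ mτ S v) ^ (4 + 2 * ⌈|z.re|⌉₊) := Finset.prod_pow _ _ _
    _ ≤ ((((D' * d₀ : ℕ) : ℝ) * (Cτ * τa S)) ^ Module.finrank ℚ (Fp L)) ^ (4 + 2 * ⌈|z.re|⌉₊) :=
        pow_le_pow_left₀ (Finset.prod_nonneg fun v _ => by positivity) (hprod.trans hnormy) _
    _ ≤ ((((D' : ℝ) * d₀) * ((Cτ + 1) * (1 + τa S))) ^ Module.finrank ℚ (Fp L)) ^ (4 + 2 * ⌈|z.re|⌉₊) :=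
        pow_le_pow_left₀ (pow_nonneg hbase0 _) (pow_le_pow_left₀ hbase0 hbase _) _
    _ = (((d₀ : ℝ) * (Cτ + 1)) ^ Module.finrank ℚ (Fp L)) ^ (4 + 2 * ⌈|z.re|⌉₊) * (1 + τa S) ^ (Module.finrank ℚ (Fp L) * (4 + 2 * ⌈|z.re|⌉₊)) *
          (D' : ℝ) ^ (Module.finrank ℚ (Fp L) * (4 + 2 * ⌈|z.re|⌉₊)) := by
        simp only [mul_pow, ← pow_mul]
        ring

end Size

end Summit.HodgeConjecture.HodgeConjecture.Cruxes.HLiu418.K2LiuKindOneSingularShellSize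

end
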